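import Literature.MathematicalPhysics.QuantumFieldTheory.Balaban1983to89.B9Eq3132TentBumps

/-!
# `Balaban1983to89.B9Eq3132TentOverlap` — T. Bałaban, *Propagators and renormalization transformations for lattice gauge theories. II*, Commun. Math. Phys. **96** (1984)
# 223–250 [Balaban1984PropagatorsII], (2.147) p. 248, (2.45) p. 231 with [Balaban1985BackgroundPropagators] (3.13) p. 393: OVERLAPS OF THE TRANSPORTED TENT BUMPS
# (`≤ 2(d+1)` on a bond, `≤ 8(d+1)` curls on a plaquette, `≤ 4(d+1)²` divergences at a site) AND THE FLAT AVERAGING TERM `‖Q(U)T_θΨ‖²_w ≤ C_Q‖Ψ‖²`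
# (part 4 of step F-d of the (P′1) roadmap for row 26's `hP1`)

statement-level skeleton of published theorems with citation tags; proofs where landed; nothing here is a claim about the Yang–Mills mass gap

THE PRINT.  [4] (2.45) p. 231 (the carrier blocks `𝔅`), (2.147) p. 248, (2.16) p. 225 (the weight band); [B9] (3.13) p. 393 (`Q(U)` with transporters).

WHY THIS FILE (dag-n06-i gen 14, N06 bundle F4, row 26).  The test operator `T_θ = tentOp (bumpProfile)` is the superposition of the transported tents of the index bonds
(`tentOp_eq_sum_tentField`); its covariant derivatives are sums over the ≤ `2(d+1)` tents a bond can see (the tree's `card_bump_support_le`), so HS of the sum costs that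
factor (`B9Eq3132TentFlat.hs_sum_le_card_support_mul`).  The averaging term needs no smallness at all: in `B9Eq3132TentOperator.QY_tentOp_apply` the transporters
`R(τ₂)R(τ)⁻¹` are Frobenius contractions, so `HS((Q(U)T_θΨ)(y₂)) ≤ #rows·Σ_y e(y₂,y)²Λ_y²HS(Ψ(y))` with the FLAT matrix `e = (Qφ_y)_{y₂}∕m_y`, and the tree's
`card_pair_support_le` + `nu_sq_q_le` finish.

WHAT IS PROVED (sorry-free; def `CQ`).
* §2 `tentOp_eq_sum_tentField`, `tentField_eq_zero_of`, `bumpProfile_eq_zero_iff`, ★ `hs_tentOp_le`, ★ `hs_curlY_tentOp_le`, ★ `hs_divY_tentOp_le`.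
* §3 `trIP_self_eq_sum_hs`, ★ `hs_sum_smul_le` (weighted Cauchy–Schwarz), `hs_qrow_tent_le`, ★★ `trIP_QY_tentOp_le`.

HONEST SCOPE.  Finite algebra over def-Y's letters and the tree's counts; nothing of [B9] asserted; count-neutral; N06 NOT discharged.  Cell `pub-ymgap` (HUMAN RULING D-0062),
Track A node N06 [B9], seat `pub-ymgap-dag-n06-i` (gen 14), 2026-08-27; a NEW file.
-/

noncomputable section

namespace Literature.MathematicalPhysics.QuantumFieldTheory.Balaban1983to89.B9Eq3132TentOverlap

open Node00
open B6KLevelCensusIndexV1 (KIdx)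
open B6GlobalChartV1 (PV domT)
open B6Ineq2142KLevelV1 (lvl base qwt qwt_nonneg)
open B5Eq118OneStroke (iterBlock mem_iterBlock)
open B15DeterminingSets (embIter)
open B9Eq39Adjoint (R R_add R_sub R_mul R_one R_smul R_zero)
open B9Thm311ReadingCoords (trIP trIP_eq_re_trace)
open B9Ineq369CurvatureSmallAtLettersY (hs_nonneg hs_R_le trIP_one_self_eq norm_weight_eq)
open B9Thm311PosOfPrincipalAtLettersY (norm_reHolY_sub_one_le norm_imHolY_le)
open B9Eq3132NuReading (lamY lamY_pos)
open B9Eq3132TentOperator (tentOp QY_tentOp_apply eWt)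
open B9Eq3132TentCurl (tentField curlY_tentField divY_tentField tentOp_summand_eq_tentField)
open B9Eq3132ApproxRightInverse (bumpProfile bumpProfile_nonneg two_le_sitesPerDir mass_pos' wt_eq_lamY_sq eWt_bumpProfile)
open B9Thm311FlippedBondLetters (hs_real_smul)
open B9Eq3132TentFlat (pdiff gradSq massSq gradSq_nonneg massSq_nonneg hs_sum_le_card_support_mul hs_sum_le_card_mul)
open B9Eq3132TentKinetic (contractive_of_mem lasso_mem_unitary sum_hs_curlY_tentField_le sum_hs_divY_tentField_le sum_weight_edge_le hs_tentField_le)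
open B6QGQTestBumpsKLevelV1 (bump bump_ne_zero_imp rad loc card_bump_support_le card_pair_support_le)
open B6QGQCoerciveKLevelV1 (mass nu Cgrad tauL_last tauL_le_rad shift_mem_iff Adens Adens_nonneg bump_eq_of_mem sum_Adens_long TT2 TT2_le tsumL_ge Tsum_ge mass_mul
  nu_sq_grad_le nu_sq_q_le hwup_of_globalBand)
open B6Prop27KLevelV1 (wt wt_pos)
open B9GeoLemma21KLevelV1 (one_le_k)
open B9Eq3132Ineq2142Covariant (two_le_RMh)
open scoped Matrix Matrix.Norms.L2Operator
open B9Eq3132TentBumps (baseBlk orgY sideY sideY_pos bumpProfile_src_mem bumpProfile_fwd gradSq_hom massSq_hom cf_sq_mul_lamY_sq Cth)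

variable {N : ℕ} {d ℓ : ℕ} {hd : 1 ≤ d + 1} {hL : Odd (ℓ + 1) ∧ 1 < ℓ + 1} {b₀ b₁ : ℝ} (i : KIdx d ℓ hd hL b₀ b₁)

/-! ## §2 Overlaps: the tent operator is the superposition of the transported tents of the index bonds -/

section Overlap

variable {U : CfgY (Matrix (Fin N) (Fin N) ℂ) i} (hU : ∀ μ x, U μ x ∈ B7Prop2Explicit.unitaryUnits (Matrix (Fin N) (Fin N) ℂ))

omit hU in
/-- `T_θΨ = Σ_y tent_y` with `tent_y = tentField (θ_y) (orgY y) U (Λ_yΨ(y))`. [cite: Balaban1985BackgroundPropagators, (3.13) p.393; Balaban1984PropagatorsII, (2.147) p.248] -/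
theorem tentOp_eq_sum_tentField (θ : IBondY i → FBondY i → ℝ) (U : CfgY (Matrix (Fin N) (Fin N) ℂ) i) (Ψ : IBondY i → Matrix (Fin N) (Fin N) ℂ) :
    tentOp i θ U Ψ = ∑ y, tentField i (θ y) (orgY i y) U (lamY i y • Ψ y) := by
  funext f
  rw [Finset.sum_apply, tentOp]
  exact Finset.sum_congr rfl fun y _ => tentOp_summand_eq_tentField i θ U Ψ y f (lamY i y)

omit hU in
/-- a vanishing profile value kills the tent value. [cite: Balaban1984PropagatorsII, (2.147) p.248, bookkeeping] -/
theorem tentField_eq_zero_of {θ : FBondY i → ℝ} (x₀ : Site (PV d ℓ i.m i.K hd hL) 0) (U : CfgY (Matrix (Fin N) (Fin N) ℂ) i) (X : Matrix (Fin N) (Fin N) ℂ)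
    {b : FBondY i} (h : θ b = 0) : tentField i θ x₀ U X b = 0 := by
  rw [tentField, h, Complex.ofReal_zero, zero_smul]

omit hU in
/-- `θ_y(f) = 0` iff `φ_y(f) = 0`. [cite: Balaban1984PropagatorsII, (2.147) p.248, bookkeeping] -/
theorem bumpProfile_eq_zero_iff (y : IBondY i) (f : FBondY i) : bumpProfile i y f = 0 ↔ bump i.hN i.D i.hk y f = 0 := by
  rw [bumpProfile, div_eq_zero_iff, or_iff_left (mass_pos' i y).ne']

/-- ★ **AT MOST `2(d+1)` TENTS ON A BOND**: `HS((T_θΨ)(b)) ≤ 2(d+1)·Σ_y HS(tent_y(b))`. [cite: Balaban1984PropagatorsII, (2.45) p.231, (2.147) p.248] -/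
theorem hs_tentOp_le (Ψ : IBondY i → Matrix (Fin N) (Fin N) ℂ) (b : FBondY i) :
    ∑ a, ∑ c, ‖tentOp i (bumpProfile i) U Ψ b a c‖ ^ 2 ≤
      (2 * ((d : ℝ) + 1)) * ∑ y, ∑ a, ∑ c, ‖tentField i (bumpProfile i y) (orgY i y) U (lamY i y • Ψ y) b a c‖ ^ 2 := by
  classical
  rw [tentOp_eq_sum_tentField, Finset.sum_apply]
  obtain ⟨S, hcard, hS⟩ : ∃ S : Finset (IBondY i), S.card ≤ 2 * (d + 1) ∧
      ∀ y, tentField i (bumpProfile i y) (orgY i y) U (lamY i y • Ψ y) b ≠ 0 → y ∈ S :=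
    ⟨_, card_bump_support_le i.hN i.D i.hk (one_le_k i) b, fun y hy => Finset.mem_filter.2 ⟨Finset.mem_univ _, by
      have h0 : bump i.hN i.D i.hk y b ≠ 0 := fun h0 => hy (tentField_eq_zero_of i _ _ _ ((bumpProfile_eq_zero_iff i y b).2 h0))
      simpa using h0⟩⟩
  refine (hs_sum_le_card_support_mul S _ hS).trans (mul_le_mul_of_nonneg_right ?_ (Finset.sum_nonneg fun _ _ => hs_nonneg _))
  have : (S.card : ℝ) ≤ ((2 * (d + 1) : ℕ) : ℝ) := by exact_mod_cast hcard
  push_cast at this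
  exact this

/-- **AT MOST `8(d+1)` TENTS HAVE A CURL ON A PLAQUETTE**: `HS((D_U T_θΨ)(p)) ≤ 8(d+1)·Σ_y HS((D_U tent_y)(p))`. [cite: Balaban1984PropagatorsII, (2.45) p.231, (2.147) p.248] -/
theorem hs_curlY_tentOp_le (Ψ : IBondY i → Matrix (Fin N) (Fin N) ℂ) (p : PlaqY i) :
    ∑ a, ∑ c, ‖curlY i U (tentOp i (bumpProfile i) U Ψ) p a c‖ ^ 2 ≤
      (8 * ((d : ℝ) + 1)) * ∑ y, ∑ a, ∑ c, ‖curlY i U (tentField i (bumpProfile i y) (orgY i y) U (lamY i y • Ψ y)) p a c‖ ^ 2 := by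
  classical
  rw [tentOp_eq_sum_tentField, map_sum, Finset.sum_apply]
  have hT : ∀ m : Fin 4, ∃ T : Finset (IBondY i), T.card ≤ 2 * (d + 1) ∧ ∀ y, bump i.hN i.D i.hk y (edgeY i p m) ≠ 0 → y ∈ T := fun m =>
    ⟨_, card_bump_support_le i.hN i.D i.hk (one_le_k i) (edgeY i p m), fun y hy => Finset.mem_filter.2 ⟨Finset.mem_univ _, by simpa using hy⟩⟩
  choose T hTcard hT using hT
  set S := Finset.univ.biUnion T
  have hS : ∀ y, curlY i U (tentField i (bumpProfile i y) (orgY i y) U (lamY i y • Ψ y)) p ≠ 0 → y ∈ S := by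
    intro y hy
    by_contra hc
    apply hy
    have hz : ∀ m : Fin 4, bumpProfile i y (edgeY i p m) = 0 := by
      intro m
      rw [bumpProfile_eq_zero_iff]
      by_contra h
      exact hc (Finset.mem_biUnion.2 ⟨m, Finset.mem_univ _, hT m y h⟩)
    have e0 : bumpProfile i y ⟨p.src.shift p.ν, p.μ⟩ = 0 := hz 0
    have e1 : bumpProfile i y ⟨p.src, p.ν⟩ = 0 := hz 1
    have e2 : bumpProfile i y ⟨p.src, p.μ⟩ = 0 := hz 2
    have e3 : bumpProfile i y ⟨p.src.shift p.μ, p.ν⟩ = 0 := hz 3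
    rw [curlY_tentField, e0, e1, e2, e3]
    simp
  refine (hs_sum_le_card_support_mul S _ hS).trans (mul_le_mul_of_nonneg_right ?_ (Finset.sum_nonneg fun _ _ => hs_nonneg _))
  have h : S.card ≤ 4 * (2 * (d + 1)) := by
    refine Finset.card_biUnion_le.trans ?_
    calc ∑ m : Fin 4, (T m).card ≤ ∑ _m : Fin 4, 2 * (d + 1) := Finset.sum_le_sum fun m _ => hTcard m
      _ = 4 * (2 * (d + 1)) := by rw [Finset.sum_const, Finset.card_univ, Fintype.card_fin, smul_eq_mul]
  have : (S.card : ℝ) ≤ ((4 * (2 * (d + 1)) : ℕ) : ℝ) := by exact_mod_cast h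
  push_cast at this
  linarith

/-- **AT MOST `4(d+1)²` TENTS HAVE A DIVERGENCE AT A SITE**: `HS((D\*_U T_θΨ)(x)) ≤ 4(d+1)²·Σ_y HS((D\*_U tent_y)(x))`. [cite: Balaban1984PropagatorsII, (2.45) p.231, (2.147) p.248] -/
theorem hs_divY_tentOp_le (Ψ : IBondY i → Matrix (Fin N) (Fin N) ℂ) (s : SiteY i) :
    ∑ a, ∑ c, ‖divY i U (tentOp i (bumpProfile i) U Ψ) s a c‖ ^ 2 ≤
      (4 * ((d : ℝ) + 1) ^ 2) * ∑ y, ∑ a, ∑ c, ‖divY i U (tentField i (bumpProfile i y) (orgY i y) U (lamY i y • Ψ y)) s a c‖ ^ 2 := by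
  classical
  rw [tentOp_eq_sum_tentField, map_sum, Finset.sum_apply]
  set x := (B6GlobalChartV1.boxEquiv i.hN).symm s
  have hT : ∀ b : FBondY i, ∃ T : Finset (IBondY i), T.card ≤ 2 * (d + 1) ∧ ∀ y, bump i.hN i.D i.hk y b ≠ 0 → y ∈ T := fun b =>
    ⟨_, card_bump_support_le i.hN i.D i.hk (one_le_k i) b, fun y hy => Finset.mem_filter.2 ⟨Finset.mem_univ _, by simpa using hy⟩⟩
  choose T hTcard hT using hT
  set S := Finset.univ.biUnion fun κ : Fin (PV d ℓ i.m i.K hd hL).d => T ⟨x.unshift κ, κ⟩ ∪ T ⟨x, κ⟩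
  have hS : ∀ y, divY i U (tentField i (bumpProfile i y) (orgY i y) U (lamY i y • Ψ y)) s ≠ 0 → y ∈ S := by
    intro y hy
    by_contra hc
    apply hy
    have hz : ∀ κ : Fin (PV d ℓ i.m i.K hd hL).d, bumpProfile i y ⟨x.unshift κ, κ⟩ = 0 ∧ bumpProfile i y ⟨x, κ⟩ = 0 := by
      intro κ
      rw [bumpProfile_eq_zero_iff, bumpProfile_eq_zero_iff]
      by_contra h
      rw [not_and_or] at h
      apply hc
      refine Finset.mem_biUnion.2 ⟨κ, Finset.mem_univ _, ?_⟩
      rcases h with h | h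
      · exact Finset.mem_union_left _ (hT _ y h)
      · exact Finset.mem_union_right _ (hT _ y h)
    rw [divY_tentField, Finset.sum_eq_zero (fun κ _ => by rw [(hz κ).1, (hz κ).2]; simp), R_zero, smul_zero]
  refine (hs_sum_le_card_support_mul S _ hS).trans (mul_le_mul_of_nonneg_right ?_ (Finset.sum_nonneg fun _ _ => hs_nonneg _))
  have hD : Fintype.card (Fin (PV d ℓ i.m i.K hd hL).d) = d + 1 := by rw [Fintype.card_fin]
  have h : S.card ≤ (d + 1) * (2 * (d + 1) + 2 * (d + 1)) := by
    refine Finset.card_biUnion_le.trans ?_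
    calc ∑ κ : Fin (PV d ℓ i.m i.K hd hL).d, (T ⟨x.unshift κ, κ⟩ ∪ T ⟨x, κ⟩).card
        ≤ ∑ _κ : Fin (PV d ℓ i.m i.K hd hL).d, (2 * (d + 1) + 2 * (d + 1)) := Finset.sum_le_sum fun κ _ =>
          (Finset.card_union_le _ _).trans (add_le_add (hTcard _) (hTcard _))
      _ = (d + 1) * (2 * (d + 1) + 2 * (d + 1)) := by rw [Finset.sum_const, Finset.card_univ, hD, smul_eq_mul]
  have : (S.card : ℝ) ≤ (((d + 1) * (2 * (d + 1) + 2 * (d + 1)) : ℕ) : ℝ) := by exact_mod_cast h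
  push_cast at this
  nlinarith

end Overlap

/-! ## §3 ★★ The averaging term `‖Q(U)T_θΨ‖²_w` is flat (the transporters are isometries) -/

section QTerm

variable {U : CfgY (Matrix (Fin N) (Fin N) ℂ) i} (hU : ∀ μ x, U μ x ∈ B7Prop2Explicit.unitaryUnits (Matrix (Fin N) (Fin N) ℂ))
include hU

omit i hU in
/-- `⟨Φ, Φ⟩_w = Σ_s w(s)·HS(Φ(s))`. [cite: Balaban1985BackgroundPropagators, p.393 (scalar products), bookkeeping] -/
theorem trIP_self_eq_sum_hs {S : Type} [Fintype S] (w : S → ℝ) (Φ : S → Matrix (Fin N) (Fin N) ℂ) :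
    trIP w Φ Φ = ∑ s, w s * ∑ a, ∑ c, ‖Φ s a c‖ ^ 2 := by
  rw [trIP_eq_re_trace]
  exact Finset.sum_congr rfl fun s _ => by rw [B9Ineq369CurvatureSmallAtLettersY.hs_eq_re_trace]

omit i hU in
/-- **WEIGHTED CAUCHY–SCHWARZ for a non-negative combination of matrices**: `HS(Σ_f c_f M_f) ≤ (Σ_f c_f)·Σ_f c_f·HS(M_f)` (`c ≥ 0`).
[cite: Balaban1984PropagatorsI, (1.18) p.20 (the averaging weights are a probability), bookkeeping] -/
theorem hs_sum_smul_le {ι : Type} [Fintype ι] (c : ι → ℝ) (hc : ∀ f, 0 ≤ c f) (M : ι → Matrix (Fin N) (Fin N) ℂ) :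
    ∑ a, ∑ b, ‖(∑ f, (((c f : ℝ)) : ℂ) • M f) a b‖ ^ 2 ≤ (∑ f, c f) * ∑ f, c f * ∑ a, ∑ b, ‖M f a b‖ ^ 2 := by
  have hcomm : ∑ f, c f * ∑ a, ∑ b, ‖M f a b‖ ^ 2 = ∑ a, ∑ b, ∑ f, c f * ‖M f a b‖ ^ 2 := by
    simp_rw [Finset.mul_sum]
    rw [Finset.sum_comm]
    exact Finset.sum_congr rfl fun a _ => Finset.sum_comm
  rw [hcomm, Finset.mul_sum]
  refine Finset.sum_le_sum fun a _ => ?_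
  rw [Finset.mul_sum]
  refine Finset.sum_le_sum fun b _ => ?_
  rw [Matrix.sum_apply]
  have h1 : ‖∑ f, ((((c f : ℝ)) : ℂ) • M f) a b‖ ≤ ∑ f, c f * ‖M f a b‖ := by
    refine (norm_sum_le _ _).trans (Finset.sum_le_sum fun f _ => ?_)
    rw [Matrix.smul_apply, norm_smul, Complex.norm_real, Real.norm_eq_abs, abs_of_nonneg (hc f)]
  have h2 : (∑ f, c f * ‖M f a b‖) ^ 2 ≤ (∑ f, c f) * ∑ f, c f * ‖M f a b‖ ^ 2 := by
    have h := Finset.sum_mul_sq_le_sq_mul_sq Finset.univ (fun f => Real.sqrt (c f)) (fun f => Real.sqrt (c f) * ‖M f a b‖)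
    have e1 : ∀ f, Real.sqrt (c f) * (Real.sqrt (c f) * ‖M f a b‖) = c f * ‖M f a b‖ := fun f => by
      rw [← mul_assoc, Real.mul_self_sqrt (hc f)]
    have e2 : ∀ f, Real.sqrt (c f) ^ 2 = c f := fun f => Real.sq_sqrt (hc f)
    have e3 : ∀ f, (Real.sqrt (c f) * ‖M f a b‖) ^ 2 = c f * ‖M f a b‖ ^ 2 := fun f => by rw [mul_pow, e2]
    simp only [e1, e2, e3] at h
    exact h
  calc ‖∑ f, ((((c f : ℝ)) : ℂ) • M f) a b‖ ^ 2 ≤ (∑ f, c f * ‖M f a b‖) ^ 2 :=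
        pow_le_pow_left₀ (norm_nonneg _) h1 2
    _ ≤ _ := h2

/-- one averaged tent: `HS(Σ_f (q_{y₂}(f)θ_y(f))·R R⁻¹(Λ_yΨ(y))) ≤ e(y₂,y)²Λ_y²·HS(Ψ(y))`. [cite: Balaban1985BackgroundPropagators, (3.13) p.393; Balaban1984PropagatorsII, (2.147) p.248] -/
theorem hs_qrow_tent_le (Ψ : IBondY i → Matrix (Fin N) (Fin N) ℂ) (y₂ y : IBondY i) :
    ∑ a, ∑ c, ‖(∑ f, (qwt i.hN i.D i.hk y₂ f * bumpProfile i y f) •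
        R (qT i (parBY i) U y₂ f) (R (qT i (parBY i) U y f)⁻¹ (lamY i y • Ψ y))) a c‖ ^ 2 ≤
      eWt i (bumpProfile i) y₂ y ^ 2 * (lamY i y ^ 2 * ∑ a, ∑ c, ‖Ψ y a c‖ ^ 2) := by
  have hc : ∀ f, 0 ≤ qwt i.hN i.D i.hk y₂ f * bumpProfile i y f := fun f => mul_nonneg (qwt_nonneg _ _ _ _ _) (bumpProfile_nonneg i y f)
  have e : (∑ f, (qwt i.hN i.D i.hk y₂ f * bumpProfile i y f) • R (qT i (parBY i) U y₂ f) (R (qT i (parBY i) U y f)⁻¹ (lamY i y • Ψ y))) =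
      ∑ f, ((((qwt i.hN i.D i.hk y₂ f * bumpProfile i y f : ℝ)) : ℂ) • R (qT i (parBY i) U y₂ f) (R (qT i (parBY i) U y f)⁻¹ (lamY i y • Ψ y))) :=
    Finset.sum_congr rfl fun f _ => by rw [Complex.coe_smul]
  rw [e]
  refine (hs_sum_smul_le _ hc _).trans ?_
  rw [eWt, sq, mul_assoc]
  refine mul_le_mul_of_nonneg_left ?_ (Finset.sum_nonneg fun f _ => hc f)
  rw [Finset.sum_mul]
  refine Finset.sum_le_sum fun f _ => mul_le_mul_of_nonneg_left ?_ (hc f)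
  have h1 := hs_R_le (V := qT i (parBY i) U y₂ f) (contractive_of_mem (parBY_mem i hU _ _)) (R (qT i (parBY i) U y f)⁻¹ (lamY i y • Ψ y))
  have h2 := hs_R_le (V := (qT i (parBY i) U y f)⁻¹) (contractive_of_mem (Subgroup.inv_mem _ (parBY_mem i hU _ _))) (lamY i y • Ψ y)
  have h3 : ∑ a, ∑ c, ‖(lamY i y • Ψ y) a c‖ ^ 2 = lamY i y ^ 2 * ∑ a, ∑ c, ‖Ψ y a c‖ ^ 2 := by rw [← Complex.coe_smul, hs_real_smul]
  exact h1.trans (h2.trans h3.le)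

omit i hU in
/-- the `Q`-overlap constant `4(d+1)L^{d+1}` and the flat `Q`-energy constant `(25∕8)b₁L^{d+1}`, multiplied. [cite: Balaban1984PropagatorsII, (2.147) p.248, (2.16) p.225, bookkeeping ours] -/
def CQ (d ℓ : ℕ) (b₁ : ℝ) : ℝ := (4 * ((d : ℝ) + 1) * (((ℓ + 1 : ℕ) : ℝ)) ^ (d + 1)) * ((25 / 8) * b₁ * (((ℓ + 1 : ℕ) : ℝ)) ^ (d + 1))

/-- ★★ **THE AVERAGING TERM IS FLAT**: `⟨Q(U)T_θΨ, Q(U)T_θΨ⟩_w ≤ C_Q(d, L, b₁)·⟨Ψ, Ψ⟩₁` at every unitary-valued `U` — termwise Frobenius isometry, the tree's row overlap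
`card_pair_support_le` and `Q`-homogeneity `nu_sq_q_le`. [cite: Balaban1984PropagatorsII, (2.147) p.248, (2.16) p.225; Balaban1985BackgroundPropagators, (3.13) p.393] -/
theorem trIP_QY_tentOp_le (hb₁ : 0 ≤ b₁) (Ψ : IBondY i → Matrix (Fin N) (Fin N) ℂ) :
    trIP i.w (QY i (parBY i) U (tentOp i (bumpProfile i) U Ψ)) (QY i (parBY i) U (tentOp i (bumpProfile i) U Ψ)) ≤
      CQ d ℓ b₁ * trIP (fun _ => (1 : ℝ)) Ψ Ψ := by
  classical
  have hper : ∀ n, n ≤ i.k + 1 → 2 ≤ (PV d ℓ i.m i.K hd hL).sitesPerDir n := fun n _ => two_le_sitesPerDir i n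
  rw [trIP_self_eq_sum_hs, trIP_one_self_eq]
  -- per row `y₂`
  have hrow : ∀ y₂ : IBondY i, ∑ a, ∑ c, ‖QY i (parBY i) U (tentOp i (bumpProfile i) U Ψ) y₂ a c‖ ^ 2 ≤
      (4 * ((d : ℝ) + 1) * (((ℓ + 1 : ℕ) : ℝ)) ^ (d + 1)) * ∑ y, eWt i (bumpProfile i) y₂ y ^ 2 * (lamY i y ^ 2 * ∑ a, ∑ c, ‖Ψ y a c‖ ^ 2) := by
    intro y₂
    rw [QY_tentOp_apply]
    obtain ⟨S, hScard, hS0⟩ : ∃ S : Finset (IBondY i), S.card ≤ 2 * (ℓ + 1) ^ (d + 1) * (2 * (d + 1)) ∧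
        ∀ y, B6SectAOperatorsV1.QE (domT i.hN i.D i.hk) (bump i.hN i.D i.hk y) y₂ ≠ 0 → y ∈ S :=
      ⟨_, card_pair_support_le i.hN i.D i.hk (one_le_k i) (two_le_RMh i) y₂, fun y hy => Finset.mem_filter.2 ⟨Finset.mem_univ _, by simpa using hy⟩⟩
    have hS : ∀ y, (∑ f, (qwt i.hN i.D i.hk y₂ f * bumpProfile i y f) •
        R (qT i (parBY i) U y₂ f) (R (qT i (parBY i) U y f)⁻¹ (lamY i y • Ψ y))) ≠ 0 → y ∈ S := by
      intro y hy
      refine hS0 y fun h0 => hy ?_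
      have he : eWt i (bumpProfile i) y₂ y = 0 := by rw [eWt_bumpProfile, h0, zero_div]
      have hc : ∀ f, 0 ≤ qwt i.hN i.D i.hk y₂ f * bumpProfile i y f := fun f => mul_nonneg (qwt_nonneg _ _ _ _ _) (bumpProfile_nonneg i y f)
      have hz := (Finset.sum_eq_zero_iff_of_nonneg fun f (_ : f ∈ Finset.univ) => hc f).1 he
      exact Finset.sum_eq_zero fun f hf => by rw [hz f hf, zero_smul]
    refine (hs_sum_le_card_support_mul S _ hS).trans ?_
    have hcard : (S.card : ℝ) ≤ 4 * ((d : ℝ) + 1) * (((ℓ + 1 : ℕ) : ℝ)) ^ (d + 1) := by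
      have : (S.card : ℝ) ≤ ((2 * (ℓ + 1) ^ (d + 1) * (2 * (d + 1)) : ℕ) : ℝ) := by exact_mod_cast hScard
      push_cast at this
      have hL : (((ℓ + 1 : ℕ) : ℝ)) = (ℓ : ℝ) + 1 := by push_cast; ring
      rw [hL]; linarith
    exact mul_le_mul hcard (Finset.sum_le_sum fun y _ => hs_qrow_tent_le i hU Ψ y₂ y) (Finset.sum_nonneg fun _ _ => hs_nonneg _) (by positivity)
  -- sum the rows with the weights, swap, and use the `Q`-homogeneity of each bump
  have hw0 : ∀ y₂, 0 ≤ i.w y₂ := fun y₂ => (i.hw y₂).le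
  calc ∑ y₂, i.w y₂ * ∑ a, ∑ c, ‖QY i (parBY i) U (tentOp i (bumpProfile i) U Ψ) y₂ a c‖ ^ 2
      ≤ ∑ y₂, i.w y₂ * ((4 * ((d : ℝ) + 1) * (((ℓ + 1 : ℕ) : ℝ)) ^ (d + 1)) * ∑ y, eWt i (bumpProfile i) y₂ y ^ 2 * (lamY i y ^ 2 * ∑ a, ∑ c, ‖Ψ y a c‖ ^ 2)) :=
        Finset.sum_le_sum fun y₂ _ => mul_le_mul_of_nonneg_left (hrow y₂) (hw0 y₂)
    _ = (4 * ((d : ℝ) + 1) * (((ℓ + 1 : ℕ) : ℝ)) ^ (d + 1)) * ∑ y, (lamY i y ^ 2 * ∑ y₂, i.w y₂ * eWt i (bumpProfile i) y₂ y ^ 2) * ∑ a, ∑ c, ‖Ψ y a c‖ ^ 2 := by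
        set K := (4 * ((d : ℝ) + 1) * (((ℓ + 1 : ℕ) : ℝ)) ^ (d + 1))
        have lhs : ∑ y₂, i.w y₂ * (K * ∑ y, eWt i (bumpProfile i) y₂ y ^ 2 * (lamY i y ^ 2 * ∑ a, ∑ c, ‖Ψ y a c‖ ^ 2)) =
            ∑ y₂, ∑ y, K * (i.w y₂ * eWt i (bumpProfile i) y₂ y ^ 2) * (lamY i y ^ 2 * ∑ a, ∑ c, ‖Ψ y a c‖ ^ 2) := by
          refine Finset.sum_congr rfl fun y₂ _ => ?_
          rw [Finset.mul_sum, Finset.mul_sum]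
          exact Finset.sum_congr rfl fun y _ => by ring
        have rhs : K * ∑ y, (lamY i y ^ 2 * ∑ y₂, i.w y₂ * eWt i (bumpProfile i) y₂ y ^ 2) * ∑ a, ∑ c, ‖Ψ y a c‖ ^ 2 =
            ∑ y, ∑ y₂, K * (i.w y₂ * eWt i (bumpProfile i) y₂ y ^ 2) * (lamY i y ^ 2 * ∑ a, ∑ c, ‖Ψ y a c‖ ^ 2) := by
          rw [Finset.mul_sum]
          refine Finset.sum_congr rfl fun y _ => ?_
          have : (lamY i y ^ 2 * ∑ y₂, i.w y₂ * eWt i (bumpProfile i) y₂ y ^ 2) * ∑ a, ∑ c, ‖Ψ y a c‖ ^ 2 =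
              ∑ y₂, (i.w y₂ * eWt i (bumpProfile i) y₂ y ^ 2) * (lamY i y ^ 2 * ∑ a, ∑ c, ‖Ψ y a c‖ ^ 2) := by
            rw [Finset.mul_sum Finset.univ (fun y₂ => i.w y₂ * eWt i (bumpProfile i) y₂ y ^ 2) (lamY i y ^ 2), Finset.sum_mul]
            exact Finset.sum_congr rfl fun y₂ _ => by ring
          rw [this, Finset.mul_sum]
          exact Finset.sum_congr rfl fun y₂ _ => by ring
        rw [lhs, rhs, Finset.sum_comm]
    _ ≤ (4 * ((d : ℝ) + 1) * (((ℓ + 1 : ℕ) : ℝ)) ^ (d + 1)) * ∑ y, ((25 / 8) * b₁ * (((ℓ + 1 : ℕ) : ℝ)) ^ (d + 1)) * ∑ a, ∑ c, ‖Ψ y a c‖ ^ 2 := by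
        refine mul_le_mul_of_nonneg_left (Finset.sum_le_sum fun y _ => mul_le_mul_of_nonneg_right ?_ (hs_nonneg _)) (by positivity)
        -- `Λ_y²Σ_{y₂} w e(y₂,y)² = (Λ_y²/m_y²)Σ_{y₂} w (Qφ_y)_{y₂}² ≤ (25/8)b₁L^D`
        have h := nu_sq_q_le i.hN i.D i.hk (one_le_k i) i.hℓ (two_le_RMh i) hper i.hcf hb₁ (hwup_of_globalBand i.hN i.D i.hk i.hcf i.hwb) y
        have hm := mass_pos' i y
        have hW := wt_pos i.hN i.D i.hk i.hcf y
        have e : lamY i y ^ 2 * ∑ y₂, i.w y₂ * eWt i (bumpProfile i) y₂ y ^ 2 =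
            (wt i.hN i.D i.hk i.cf y * ∑ y₂, i.w y₂ * B6SectAOperatorsV1.QE (domT i.hN i.D i.hk) (bump i.hN i.D i.hk y) y₂ ^ 2) / mass i.hN i.D i.hk y ^ 2 := by
          rw [← wt_eq_lamY_sq, mul_div_assoc, Finset.sum_div]
          congr 1
          exact Finset.sum_congr rfl fun y₂ _ => by rw [eWt_bumpProfile, div_pow, mul_div_assoc]
        rw [e, div_le_iff₀ (by positivity)]
        unfold nu at h
        rw [div_pow, div_mul_eq_mul_div, div_le_iff₀ (by positivity)] at h
        unfold mass at h ⊢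
        refine le_of_mul_le_mul_left ?_ hW
        calc wt i.hN i.D i.hk i.cf y * (wt i.hN i.D i.hk i.cf y * ∑ y₂, i.w y₂ * B6SectAOperatorsV1.QE (domT i.hN i.D i.hk) (bump i.hN i.D i.hk y) y₂ ^ 2)
            = wt i.hN i.D i.hk i.cf y ^ 2 * ∑ y₂, i.w y₂ * B6SectAOperatorsV1.QE (domT i.hN i.D i.hk) (bump i.hN i.D i.hk y) y₂ ^ 2 := by ring
          _ ≤ _ := h
          _ = _ := by ring
    _ = CQ d ℓ b₁ * ∑ y, ∑ a, ∑ c, ‖Ψ y a c‖ ^ 2 := by rw [CQ, Finset.mul_sum, Finset.mul_sum]; exact Finset.sum_congr rfl fun y _ => by ring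

end QTerm

end Literature.MathematicalPhysics.QuantumFieldTheory.Balaban1983to89.B9Eq3132TentOverlap

end
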